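import Literature.Analysis.InnerProduct.GramHadamard
import Mathlib.Analysis.InnerProductSpace.ProdL2
import Mathlib.Analysis.InnerProductSpace.PiL2
import Mathlib.Analysis.SpecialFunctions.Pow.Real
import HarnessLib

/-!
# The Gram–Hadamard inequality for Gram matrices with some rows replaced by unit rows

Topic `Literature/Analysis/InnerProduct`; companion of `GramHadamard.lean`
(`norm_det_inner_le_prod_norm_mul_prod_norm`: `‖det [⟪xᵢ, yⱼ⟫]‖ ≤ ∏ ‖xᵢ‖ ∏ ‖yⱼ‖`).  In the
fermionic tree expansion (Benfatto–Giuliani–Mastropietro 2006, (2.66); Mastropietro 2008,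
(2.110)–(2.119)) the determinant that remains after the propagators of the tree lines have been
extracted is the Gram determinant of the *remaining* fields; in the row-replacement bookkeeping of
`Literature/MathematicalPhysics/QuantumLattice/FermionicTreeExpansion.lean` it appears as the
determinant of the full matrix in which the rows `a ∈ I` of the fields used by tree lines are the
unit rows `e_{j a}`.  This file proves the corresponding bound

`‖det M‖ ≤ ∏_{a ∉ I} ‖x a‖ · ∏_{b ∉ j(I)} ‖y b‖`  (`norm_det_le_of_unit_rows`)

for `M a b = ⟪x a, y b⟫` (`a ∉ I`) and `M a b = δ_{b, j a}` (`a ∈ I`) — i.e. the Gram–Hadamard bound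
of the complementary minor, without ever forming the minor: realise the unit rows as inner products
in `E × ℓ²` with a scale `λ` (`X a = (0, λ e_a)`, `Y b = (y b, λ⁻¹ Σ_{a ∈ I, j a = b} e_a)`), apply
Gram–Hadamard for every `λ > 0`, and let `λ → 0`.  Everything is proved; no named fact. [folklore]
-/

noncomputable section

open Finset Matrix Filter
open scoped InnerProductSpace Topology

namespace Literature.Analysis.InnerProduct

variable {𝕜 : Type*} [RCLike 𝕜] {E : Type*} [NormedAddCommGroup E] [InnerProductSpace 𝕜 E]

/-- The multiplicity of the column `b` among the unit rows: `n_b = #{a ∈ I : j a = b}`. [folklore] -/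
def colMult {n : ℕ} (I : Finset (Fin n)) (j : Fin n → Fin n) (b : Fin n) : ℕ :=
  (I.filter fun a => j a = b).card

/-- `Σ_b n_b = |I|`. [folklore] -/
theorem sum_colMult {n : ℕ} (I : Finset (Fin n)) (j : Fin n → Fin n) :
    ∑ b, colMult I j b = I.card := by
  rw [card_eq_sum_card_fiberwise (f := j) (t := univ) fun _ _ => mem_univ _]
  rfl

/-- Columns not hit by a unit row have multiplicity zero. [folklore] -/
theorem colMult_eq_zero_iff {n : ℕ} (I : Finset (Fin n)) (j : Fin n → Fin n) (b : Fin n) :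
    colMult I j b = 0 ↔ b ∉ I.image j := by
  rw [colMult, card_eq_zero, filter_eq_empty_iff, mem_image]
  exact ⟨fun h ⟨a, ha, hab⟩ => h ha hab, fun h a ha hab => h ⟨a, ha, hab⟩⟩

/-- The `λ`-dependent column factor `F_b(λ) = √(λ^{2n_b} ‖y b‖² + λ^{2n_b-2} n_b)` for `n_b ≥ 1`, and
`‖y b‖` for `n_b = 0`. [folklore] -/
def colFactor {n : ℕ} (I : Finset (Fin n)) (j : Fin n → Fin n) (y : Fin n → E) (b : Fin n) (t : ℝ) : ℝ :=
  if colMult I j b = 0 then ‖y b‖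
  else Real.sqrt (t ^ (2 * colMult I j b) * ‖y b‖ ^ 2 + t ^ (2 * colMult I j b - 2) * colMult I j b)

/-- The column factor is continuous in `λ`. [folklore] -/
theorem continuous_colFactor {n : ℕ} (I : Finset (Fin n)) (j : Fin n → Fin n) (y : Fin n → E) (b : Fin n) :
    Continuous (colFactor I j y b) := by
  unfold colFactor
  split_ifs
  · exact continuous_const
  · exact Real.continuous_sqrt.comp (by fun_prop)

/-- The value of the column factor at `λ = 0`: `‖y b‖`, `1` or `0` according as `n_b = 0, 1, ≥ 2`;
in all cases at most `‖y b‖` if `n_b = 0` and at most `1` otherwise. [folklore] -/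
theorem colFactor_zero_le {n : ℕ} (I : Finset (Fin n)) (j : Fin n → Fin n) (y : Fin n → E) (b : Fin n) :
    colFactor I j y b 0 ≤ if b ∈ I.image j then 1 else ‖y b‖ := by
  unfold colFactor
  by_cases h0 : colMult I j b = 0
  · rw [if_pos h0, if_neg ((colMult_eq_zero_iff I j b).1 h0)]
  · rw [if_neg h0, if_pos (by simpa [colMult_eq_zero_iff] using h0)]
    have hpos : 0 < colMult I j b := Nat.pos_of_ne_zero h0
    rw [zero_pow (by omega), zero_mul, zero_add]
    rcases Nat.lt_or_ge 1 (colMult I j b) with h2 | h1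
    · rw [zero_pow (by omega), zero_mul, Real.sqrt_zero]; exact zero_le_one
    · have h1' : colMult I j b = 1 := le_antisymm h1 hpos
      rw [h1']; norm_num

/-- For `λ > 0` the column factor is `λ^{n_b} √(‖y b‖² + λ⁻² n_b)`. [folklore] -/
theorem colFactor_eq {n : ℕ} (I : Finset (Fin n)) (j : Fin n → Fin n) (y : Fin n → E) (b : Fin n)
    {t : ℝ} (ht : 0 < t) :
    colFactor I j y b t = t ^ colMult I j b * Real.sqrt (‖y b‖ ^ 2 + t⁻¹ ^ 2 * colMult I j b) := by
  unfold colFactor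
  by_cases h0 : colMult I j b = 0
  · rw [if_pos h0, h0, pow_zero, one_mul, Nat.cast_zero, mul_zero, add_zero, Real.sqrt_sq (norm_nonneg _)]
  · rw [if_neg h0]
    obtain ⟨m, hm⟩ : ∃ m, colMult I j b = m + 1 := ⟨colMult I j b - 1, by omega⟩
    rw [hm, show 2 * (m + 1) - 2 = 2 * m by omega, ← Real.sqrt_sq (pow_nonneg ht.le (m + 1)),
      ← Real.sqrt_mul (sq_nonneg _)]
    congr 1
    have ht0 : t ≠ 0 := ht.ne'
    field_simp
    ring

/-- **Gram–Hadamard with unit rows.**  Let `M` be a square matrix whose row `a` is the unit row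
`e_{j a}` for `a ∈ I` and the Gram row `b ↦ ⟪x a, y b⟫` for `a ∉ I`.  Then
`‖det M‖ ≤ ∏_{a ∉ I} ‖x a‖ · ∏_{b ∉ j(I)} ‖y b‖` — the Gram–Hadamard bound for the minor obtained by
deleting the unit rows and their columns (if two unit rows share a column both sides are
compatible with `det M = 0`). [folklore] -/
theorem norm_det_le_of_unit_rows {n : ℕ} (M : Matrix (Fin n) (Fin n) 𝕜) (I : Finset (Fin n))
    (j : Fin n → Fin n) (x y : Fin n → E)
    (hM : ∀ a b, M a b = if a ∈ I then (if b = j a then 1 else 0) else ⟪x a, y b⟫_𝕜) :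
    ‖M.det‖ ≤ (∏ a ∈ univ.filter (· ∉ I), ‖x a‖) * ∏ b ∈ univ.filter (· ∉ I.image j), ‖y b‖ := by
  -- Step 1: for every `λ > 0`, `‖det M‖ ≤ ∏_{a ∉ I} ‖x a‖ · ∏_b F_b(λ)`.
  have step : ∀ t : ℝ, 0 < t →
      ‖M.det‖ ≤ (∏ a ∈ univ.filter (· ∉ I), ‖x a‖) * ∏ b, colFactor I j y b t := by
    intro t ht
    -- the dilated vectors in `E × ℓ²(n)`
    let X : Fin n → WithLp 2 (E × EuclideanSpace 𝕜 (Fin n)) := fun a =>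
      if a ∈ I then WithLp.toLp 2 (0, EuclideanSpace.single a (t : 𝕜)) else WithLp.toLp 2 (x a, 0)
    let Y : Fin n → WithLp 2 (E × EuclideanSpace 𝕜 (Fin n)) := fun b =>
      WithLp.toLp 2 (y b, WithLp.toLp 2 fun a => if a ∈ I ∧ j a = b then ((t : 𝕜)⁻¹) else 0)
    have hXY : ∀ a b, ⟪X a, Y b⟫_𝕜 = M a b := by
      intro a b
      rw [hM]
      by_cases ha : a ∈ I
      · simp only [X, Y, if_pos ha, WithLp.prod_inner_apply, inner_zero_left, zero_add,
          EuclideanSpace.inner_single_left, ha, true_and, RCLike.conj_ofReal, if_true]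
        have ht0 : (t : 𝕜) ≠ 0 := by exact_mod_cast ht.ne'
        by_cases hb : j a = b
        · rw [if_pos hb, if_pos hb.symm, mul_inv_cancel₀ ht0]
        · rw [if_neg hb, if_neg (fun h => hb h.symm), mul_zero]
      · simp only [X, Y, if_neg ha, WithLp.prod_inner_apply, inner_zero_left, add_zero]
    have hXnorm : ∀ a, ‖X a‖ = if a ∈ I then t else ‖x a‖ := by
      intro a
      by_cases ha : a ∈ I
      · simp only [X, if_pos ha]
        rw [WithLp.prod_norm_eq_of_L2]
        simp [Real.sqrt_sq_eq_abs, abs_of_pos ht]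
      · simp only [X, if_neg ha]
        rw [WithLp.prod_norm_eq_of_L2]
        simp
    have hfilter : ∀ b, univ.filter (fun a => a ∈ I ∧ j a = b) = I.filter (fun a => j a = b) := by
      intro b; ext a; simp
    have hYnorm : ∀ b, ‖Y b‖ = Real.sqrt (‖y b‖ ^ 2 + t⁻¹ ^ 2 * colMult I j b) := by
      intro b
      rw [WithLp.prod_norm_eq_of_L2]
      congr 1
      simp only [Y, WithLp.toLp_snd, WithLp.toLp_fst]
      congr 1
      rw [EuclideanSpace.norm_sq_eq]
      simp only [apply_ite (fun z : 𝕜 => ‖z‖ ^ 2), norm_zero, norm_inv, RCLike.norm_ofReal,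
        abs_of_pos ht, ne_eq, OfNat.ofNat_ne_zero, not_false_eq_true, zero_pow, Finset.sum_ite, sum_const,
        nsmul_eq_mul, hfilter, mul_zero, add_zero]
      rw [colMult, mul_comm]
    -- Gram–Hadamard for the dilated vectors
    have hGH := norm_det_inner_le_prod_norm_mul_prod_norm (𝕜 := 𝕜) X Y
    have hMeq : (Matrix.of fun a b => ⟪X a, Y b⟫_𝕜) = M := by
      ext a b; exact hXY a b
    rw [hMeq] at hGH
    refine hGH.trans (le_of_eq ?_)
    -- bookkeeping: `∏_a ‖X a‖ = λ^{|I|} ∏_{a ∉ I} ‖x a‖` and `λ^{|I|} ∏_b ‖Y b‖ = ∏_b F_b(λ)`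
    have hX : ∏ a, ‖X a‖ = t ^ I.card * ∏ a ∈ univ.filter (· ∉ I), ‖x a‖ := by
      simp_rw [hXnorm]
      rw [← prod_filter_mul_prod_filter_not univ (· ∈ I)]
      congr 1
      · rw [prod_congr rfl (fun a ha => by rw [if_pos (mem_filter.1 ha).2]), prod_const]
        congr 1
        rw [filter_mem_eq_inter, univ_inter]
      · exact prod_congr rfl fun a ha => by rw [if_neg (mem_filter.1 ha).2]
    have hY : t ^ I.card * ∏ b, ‖Y b‖ = ∏ b, colFactor I j y b t := by
      rw [← sum_colMult I j, ← prod_pow_eq_pow_sum, ← prod_mul_distrib]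
      exact prod_congr rfl fun b _ => by rw [hYnorm, colFactor_eq I j y b ht]
    rw [hX, mul_comm (t ^ I.card), mul_assoc, hY]
  -- Step 2: let `λ → 0⁺`.
  have hlim : Tendsto (fun t => (∏ a ∈ univ.filter (· ∉ I), ‖x a‖) * ∏ b, colFactor I j y b t)
      (𝓝[>] 0) (𝓝 ((∏ a ∈ univ.filter (· ∉ I), ‖x a‖) * ∏ b, colFactor I j y b 0)) := by
    refine (Continuous.tendsto ?_ 0).mono_left nhdsWithin_le_nhds
    exact continuous_const.mul (continuous_finsetProd _ fun b _ => continuous_colFactor I j y b)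
  have hle : ‖M.det‖ ≤ (∏ a ∈ univ.filter (· ∉ I), ‖x a‖) * ∏ b, colFactor I j y b 0 :=
    ge_of_tendsto hlim (eventually_nhdsWithin_of_forall fun t ht => step t ht)
  refine hle.trans (mul_le_mul_of_nonneg_left ?_ (prod_nonneg fun _ _ => norm_nonneg _))
  -- `∏_b F_b(0) ≤ ∏_{b ∉ j(I)} ‖y b‖`
  calc ∏ b, colFactor I j y b 0 ≤ ∏ b, (if b ∈ I.image j then (1 : ℝ) else ‖y b‖) :=
        prod_le_prod (fun b _ => by unfold colFactor; split_ifs <;> positivity) fun b _ => colFactor_zero_le I j y b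
    _ = ∏ b ∈ univ.filter (· ∉ I.image j), ‖y b‖ := by
        rw [prod_ite, prod_const_one, one_mul]

end Literature.Analysis.InnerProduct
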